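import Summits.CriticalPhenomena.PercolationContinuityZ3.Theorems.FK.InfiniteVolumeDLROneEdgeIff
import Summits.CriticalPhenomena.PercolationContinuityZ3.Theorems.FK.BernoulliComparison
import Mathlib.MeasureTheory.Function.ConditionalExpectation.Basic
import HarnessLib

/-!
# FK-continuity transplant, FO-06/FO-10 (infinite-volume structure): the DLR equations (4.30) and (4.38) as
# conditional expectations, and the finite-energy property (4.32), for EVERY DLR random-cluster measure

Registered R72 (cell INBOX l.5361, 2026-08-23); registry row FO-10b-g407; label DLR1e-D (coordinator fk-4 g140).
Cell `fk-continuity` (bschramm), FO-10b lineage (conditional one-edge energies); support file for the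
FK-continuity transplant (`--supports stmt-CriticalPhenomena-4575`); builds on p205010 (kernel theorem,
internal audit signed; external expert review pending). No named facts, no definitions, no sorries, standard
axioms. General dimension `d`, `0 ≤ p ≤ 1`, `q > 0` (`q ≥ 1` for the finite-energy sandwich). Banked infinite-volume
structure; not an END-STATE dependency of the cell (not consumed by `_r3`); it says nothing about FH / TP_FK or
continuity at `p_c`.

The tree's `IsDLRRandomCluster d p q P` (Def. (4.29)) is the junk-free INTEGRATED form
`∫ φ^ξ_{Λ,p,q}(A) P(dξ) = P(A)`.  For the box limits `φ^b_{p,q}` FO-06b proved the textbook conditional-expectation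
forms (`IsBoxLimit.condExp_indicator_cylEvent`, `IsBoxLimit.condExp_indicator_edgeOpen`).  Here, for EVERY
`P ∈ R_{p,q}`:

* `IsDLRRandomCluster.real_cylEvent_inter_eq_setIntegral` — `P({ω ∩ E_Λ = η} ∩ H) = ∫_H φ^ξ_{Λ,p,q}(η) P(dξ)`
  for every finite region `Λ`, `η ⊆ E_Λ`, `H ∈ 𝒯_Λ`;
* `IsDLRRandomCluster.condExp_indicator_cylEvent` — **Grimmett's (4.30)**: `P[1_{ω ∩ E_Λ = η} | 𝒯_Λ] = φ^·_{Λ,p,q}(η)`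
  `P`-a.s., for every finite region;
* `IsDLRRandomCluster.condExp_indicator_edgeOpen` — **(4.38)**: `P[1_{J_e} | 𝒯_e] = p·1_{K_e} + p/(p+q(1-p))·1_{K_eᶜ}`
  `P`-a.s. (`𝒯_e` realised as `MeasurableSpace.comap (· ∖ {e})`);
* `IsDLRRandomCluster.mul_real_le_real_edgeOpen_inter`, `IsDLRRandomCluster.real_edgeOpen_inter_le_mul` — **the
  finite-energy property (4.32) / Thm. (4.17)(b) for the class `R_{p,q}`**, `q ≥ 1`: for every `𝒯_e`-event `H`,
  `p/(p+q(1-p)) · P(H) ≤ P(J_e ∩ H) ≤ p · P(H)` (the inequality `p/(p+q(1-p)) ≤ p` is the tree's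
  `ratio_le_self`, `BernoulliComparison.lean`).

## References

* G. Grimmett, *The Random-Cluster Model*, Springer 2006: Thm. (4.17)(b), Def. (4.29) eq. (4.30), eq. (4.32),
  Prop. (4.37)(a) eq. (4.38), pp. 75–82. [Grimmett2006]
-/

noncomputable section

open MeasureTheory Set Filter
open scoped Topology ENNReal

namespace Summit.CriticalPhenomena.PercolationContinuityZ3.Theorems.FK

open Literature.Probability.Percolation Literature.Probability.LatticeModels

variable {d : ℕ} {p q : ℝ} {P : Measure (BondConfig (Site d))}

namespace IsDLRRandomCluster

/-- **The DLR equation on cylinders for every `P ∈ R_{p,q}`**: `P({ω ∩ E_Λ = η} ∩ H) = ∫_H φ^ξ_{Λ,p,q}(η) P(dξ)`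
for every finite region `Λ`, inside pattern `η ⊆ E_Λ` and outside event `H ∈ 𝒯_Λ` (`0 ≤ p ≤ 1`, `q > 0`).
[cite: Grimmett2006, Def. (4.29) eq. (4.30)] -/
theorem real_cylEvent_inter_eq_setIntegral (hP : IsDLRRandomCluster d p q P) (hp : p ∈ Set.Icc (0 : ℝ) 1)
    (hq : 0 < q) (Λ : Finset (Site d)) {η : Finset (Sym2 (Site d))} (hη : η ⊆ edgesIn (zdGraph d) Λ)
    {H : Set (BondConfig (Site d))} (hH : MeasurableSet[outsideEvents d Λ] H) :
    P.real (cylEvent (edgesIn (zdGraph d) Λ) η ∩ H) = ∫ ξ in H, rcCondProb p q Λ ξ η ∂P := by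
  haveI := hP.isProbabilityMeasure
  exact real_cylEvent_inter_eq_setIntegral_of_lintegral_rcCondLaw_eq hp hq Λ
    (fun A hA => hP.lintegral_rcCondLaw_eq Λ hA) hη hH

/-- **Grimmett's DLR equation (4.30) for every `P ∈ R_{p,q}`**: for every finite region `Λ` and inside pattern
`η ⊆ E_Λ`, `P[1_{ω ∩ E_Λ = η} | 𝒯_Λ](ξ) = φ^ξ_{Λ,p,q}(η)` for `P`-a.e. `ξ` — conditionally on the configuration off
`E_Λ`, the configuration on `E_Λ` is distributed by the random-cluster measure of `Λ` with the induced boundary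
condition (`0 ≤ p ≤ 1`, `q > 0`). The tree's Def. (4.29) is the integrated form; this is the textbook form.
[cite: Grimmett2006, Def. (4.29) eq. (4.30)] -/
theorem condExp_indicator_cylEvent (hP : IsDLRRandomCluster d p q P) (hp : p ∈ Set.Icc (0 : ℝ) 1) (hq : 0 < q)
    (Λ : Finset (Site d)) {η : Finset (Sym2 (Site d))} (hη : η ⊆ edgesIn (zdGraph d) Λ) :
    (fun ξ : BondConfig (Site d) => rcCondProb p q Λ ξ η) =ᵐ[P]
      P[(cylEvent (edgesIn (zdGraph d) Λ) η).indicator (fun _ => (1 : ℝ)) | outsideEvents d Λ] := by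
  haveI := hP.isProbabilityMeasure
  have hCm : MeasurableSet (cylEvent (edgesIn (zdGraph d) Λ) η) := measurableSet_cylEvent _ η
  have hint : Integrable (fun ω => rcCondProb p q Λ ω η) P := integrable_rcCondProb P hp hq Λ hη
  refine ae_eq_condExp_of_forall_setIntegral_eq (outsideEvents_le Λ) ((integrable_const (1 : ℝ)).indicator hCm)
    (fun s _ _ => hint.integrableOn) (fun s hs _ => ?_)
    (measurable_rcCondProb_outsideEvents p q Λ η).stronglyMeasurable.aestronglyMeasurable
  rw [setIntegral_indicator hCm, setIntegral_const, smul_eq_mul, mul_one, Set.inter_comm,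
    hP.real_cylEvent_inter_eq_setIntegral hp hq Λ hη hs]

variable {x y : Site d}

/-- **(4.38) as a conditional expectation, for every `P ∈ R_{p,q}`**: for a lattice edge `e = ⟨x,y⟩`, with `𝒯_e`
the σ-algebra of the other edges (the pull-back `MeasurableSpace.comap (· ∖ {e})`),
`P[1_{e open} | 𝒯_e](ω) = p` if `x ↔ y` in `ω ∖ e` and `= p/(p + q(1-p))` otherwise, for `P`-a.e. `ω`
(`0 ≤ p ≤ 1`, `q > 0`). [cite: Grimmett2006, Prop. (4.37)(a) eq. (4.38)] -/
theorem condExp_indicator_edgeOpen (hP : IsDLRRandomCluster d p q P) (hp : p ∈ Set.Icc (0 : ℝ) 1) (hq : 0 < q)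
    [DecidablePred (· ∈ (openConn x y : Set (BondConfig (Site d))))] (hxy : (zdGraph d).Adj x y) :
    (fun ω : BondConfig (Site d) =>
        if ω \ {s(x, y)} ∈ openConn x y then p else p / (p + q * (1 - p))) =ᵐ[P]
      P[({ω : BondConfig (Site d) | s(x, y) ∈ ω}).indicator (fun _ => (1 : ℝ)) |
        MeasurableSpace.comap (fun η : BondConfig (Site d) => η \ {s(x, y)}) inferInstance] := by
  classical
  haveI := hP.isProbabilityMeasure
  set f : BondConfig (Site d) → BondConfig (Site d) := fun η => η \ {s(x, y)} with hf
  have hfm : Measurable f := measurable_closeEdges _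
  have hm : MeasurableSpace.comap f inferInstance ≤ (inferInstance : MeasurableSpace (BondConfig (Site d))) :=
    measurable_iff_comap_le.1 hfm
  have hKm : MeasurableSet (openConn x y : Set (BondConfig (Site d))) := measurableSet_openConn_holds x y
  have hJm : MeasurableSet {ω : BondConfig (Site d) | s(x, y) ∈ ω} := measurableSet_mem _
  set p' := p / (p + q * (1 - p)) with hp'
  set g : BondConfig (Site d) → ℝ := fun ω => if ω \ {s(x, y)} ∈ openConn x y then p else p' with hg
  have hg_eq : g = (f ⁻¹' openConn x y).indicator (fun _ => p) + (f ⁻¹' (openConn x y)ᶜ).indicator (fun _ => p') := by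
    funext ω
    by_cases h : ω \ {s(x, y)} ∈ openConn x y
    · simp [hg, h, hf]
    · simp [hg, h, hf]
  have hgm : Measurable[MeasurableSpace.comap f inferInstance] g := by
    have h1 : Measurable[MeasurableSpace.comap f inferInstance] f := measurable_iff_comap_le.2 le_rfl
    have h2 : Measurable fun η : BondConfig (Site d) => if η ∈ openConn x y then p else p' :=
      Measurable.ite hKm measurable_const measurable_const
    exact h2.comp h1
  refine ae_eq_condExp_of_forall_setIntegral_eq hm ((integrable_const (1 : ℝ)).indicator hJm)
    (fun s _ _ => ?_) (fun s hs _ => ?_) hgm.stronglyMeasurable.aestronglyMeasurable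
  · rw [hg_eq]
    exact (((integrable_const p).indicator (hKm.preimage hfm)).add
      ((integrable_const p').indicator (hKm.compl.preimage hfm))).integrableOn
  · obtain ⟨H₀, hH₀, rfl⟩ := MeasurableSpace.measurableSet_comap.1 hs
    have hI1 : IntegrableOn ((f ⁻¹' openConn x y).indicator fun _ => p) (f ⁻¹' H₀) P :=
      ((integrable_const p).indicator (hKm.preimage hfm)).integrableOn
    have hI2 : IntegrableOn ((f ⁻¹' (openConn x y)ᶜ).indicator fun _ => p') (f ⁻¹' H₀) P :=
      ((integrable_const p').indicator (hKm.compl.preimage hfm)).integrableOn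
    rw [hg_eq]
    simp only [Pi.add_apply]
    rw [integral_add hI1 hI2, setIntegral_indicator (hKm.preimage hfm),
      setIntegral_indicator (hKm.compl.preimage hfm), setIntegral_const, setIntegral_const, smul_eq_mul,
      smul_eq_mul, setIntegral_indicator hJm, setIntegral_const, smul_eq_mul, mul_one,
      Set.inter_comm (f ⁻¹' H₀) {ω | s(x, y) ∈ ω}, hP.real_edgeOpen_inter_preimage_eq hp hq hxy hH₀,
      Set.preimage_inter, Set.preimage_inter, Set.preimage_compl]
    ring

/-- **Finite energy of every `P ∈ R_{p,q}`, lower half** (Grimmett 2006, (4.32) / Thm. (4.17)(b) for the class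
`R_{p,q}`, `q ≥ 1`): for a lattice edge `e = ⟨x,y⟩` and every measurable `H₀`,
`p/(p + q(1-p)) · P({ω ∖ e ∈ H₀}) ≤ P({e open} ∩ {ω ∖ e ∈ H₀})` — the conditional probability that `e` is open
given everything else is at least `p/(p + q(1-p))`. [cite: Grimmett2006, Thm. (4.17)(b), eq. (4.32)] -/
theorem mul_real_le_real_edgeOpen_inter (hP : IsDLRRandomCluster d p q P) (hp : p ∈ Set.Icc (0 : ℝ) 1)
    (hq : 1 ≤ q) (hxy : (zdGraph d).Adj x y) {H₀ : Set (BondConfig (Site d))} (hH₀ : MeasurableSet H₀) :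
    p / (p + q * (1 - p)) * P.real ((fun η => η \ {s(x, y)}) ⁻¹' H₀) ≤
      P.real ({ω | s(x, y) ∈ ω} ∩ (fun η => η \ {s(x, y)}) ⁻¹' H₀) := by
  haveI := hP.isProbabilityMeasure
  have hfm : Measurable (fun η : BondConfig (Site d) => η \ {s(x, y)}) := measurable_closeEdges _
  have hKm : MeasurableSet (openConn x y : Set (BondConfig (Site d))) := measurableSet_openConn_holds x y
  rw [hP.real_edgeOpen_inter_preimage_eq hp (one_pos.trans_le hq) hxy hH₀]
  have hsplit : P.real ((fun η => η \ {s(x, y)}) ⁻¹' H₀) =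
      P.real ((fun η => η \ {s(x, y)}) ⁻¹' (H₀ ∩ openConn x y)) +
        P.real ((fun η => η \ {s(x, y)}) ⁻¹' (H₀ ∩ (openConn x y)ᶜ)) := by
    rw [Set.preimage_inter, Set.preimage_inter, Set.preimage_compl,
      ← measureReal_inter_add_sdiff₀ ((hKm.preimage hfm).nullMeasurableSet), Set.sdiff_eq]
  rw [hsplit, mul_add]
  have h1 := ratio_le_self hp hq
  have h2 : 0 ≤ P.real ((fun η => η \ {s(x, y)}) ⁻¹' (H₀ ∩ openConn x y)) := measureReal_nonneg
  nlinarith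

/-- **Finite energy of every `P ∈ R_{p,q}`, upper half** (`q ≥ 1`): for a lattice edge `e = ⟨x,y⟩` and every
measurable `H₀`, `P({e open} ∩ {ω ∖ e ∈ H₀}) ≤ p · P({ω ∖ e ∈ H₀})` — the conditional probability that `e` is
open given everything else is at most `p`. [cite: Grimmett2006, Thm. (4.17)(b), eq. (4.32)] -/
theorem real_edgeOpen_inter_le_mul (hP : IsDLRRandomCluster d p q P) (hp : p ∈ Set.Icc (0 : ℝ) 1) (hq : 1 ≤ q)
    (hxy : (zdGraph d).Adj x y) {H₀ : Set (BondConfig (Site d))} (hH₀ : MeasurableSet H₀) :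
    P.real ({ω | s(x, y) ∈ ω} ∩ (fun η => η \ {s(x, y)}) ⁻¹' H₀) ≤
      p * P.real ((fun η => η \ {s(x, y)}) ⁻¹' H₀) := by
  haveI := hP.isProbabilityMeasure
  have hfm : Measurable (fun η : BondConfig (Site d) => η \ {s(x, y)}) := measurable_closeEdges _
  have hKm : MeasurableSet (openConn x y : Set (BondConfig (Site d))) := measurableSet_openConn_holds x y
  rw [hP.real_edgeOpen_inter_preimage_eq hp (one_pos.trans_le hq) hxy hH₀]
  have hsplit : P.real ((fun η => η \ {s(x, y)}) ⁻¹' H₀) =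
      P.real ((fun η => η \ {s(x, y)}) ⁻¹' (H₀ ∩ openConn x y)) +
        P.real ((fun η => η \ {s(x, y)}) ⁻¹' (H₀ ∩ (openConn x y)ᶜ)) := by
    rw [Set.preimage_inter, Set.preimage_inter, Set.preimage_compl,
      ← measureReal_inter_add_sdiff₀ ((hKm.preimage hfm).nullMeasurableSet), Set.sdiff_eq]
  rw [hsplit, mul_add]
  have h1 := ratio_le_self hp hq
  have h2 : 0 ≤ P.real ((fun η => η \ {s(x, y)}) ⁻¹' (H₀ ∩ (openConn x y)ᶜ)) := measureReal_nonneg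
  nlinarith

end IsDLRRandomCluster

end Summit.CriticalPhenomena.PercolationContinuityZ3.Theorems.FK

end
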